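import Literature.AlgebraicGeometry.Resolution.CobordantBlowupExtReesLocalization
import Summits.ResolutionOfSingularities.ResolutionOfSingularities.Theorems.WeightedInvariantPlusStalkGameSideCompat
import HarnessLib

/-!
# CHART → GAME SIDE at a prime WITH THE COEFFICIENT MAP (res-type-048's package, re-opened)

Route `ResolutionOfSingularities/WeightedInvariant`, crux `Theses.WeightedInvariant.HypersurfaceCentreConstruction`
(stmt-ResolutionOfSingularities-19897), door line `local-engine`, E2 tier (S-b2-over) (res-L1-w43-plan-1 SPEC (Δ6b) rev 6, OFFER (o59-b2-over)).

res-type-048's package `exists_prime_extReesAlgebra_ringEquiv_localization_T` (…CentreAssemblyPullback) and its Literature form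
`IdealFiltration.exists_prime_extReesAlgebra_ringEquiv_localization` (…CobordantBlowupExtReesLocalization §6) hand, for the chart filtration
`𝒥` on `A`, a localisation `A' = M⁻¹A`, the ideals `Iₙ' = 𝒥ₙ A'` and a prime `𝔫` of `⊕ 𝒥ₙ tⁿ` missing `M`, a prime `𝔫'` of the game-side
carrier `extReesAlgebra I'` and `g : (⊕ 𝒥ₙ tⁿ)_𝔫 ≃+* (extReesAlgebra I')_{𝔫'}` with its action on the BASE `A` and on `t⁻¹`.  The `t`-homogeneity
clause of `Stage.SuccOverCentreAt` (…ELadderTwoCompatible) needs the action of `g` on EVERY element of `⊕ 𝒥ₙ tⁿ`: this file re-opens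
§5 of the Literature file and exports the COEFFICIENTWISE LOCALISATION MAP `ℓ : ⊕ 𝒥ₙ tⁿ → extReesAlgebra I'` (`a tⁿ ↦ (a/1) tⁿ`) with
* `g (z/1) = (ℓ z)/1` for every `z` (the whole compatibility), `ℓ (a·1) = (a/1)·1`, `ℓ t⁻¹ = t⁻¹`, the coefficient formula,
* `z ∈ 𝔫 ↔ ℓ z ∈ 𝔫'` (the primes correspond), and every element of `extReesAlgebra I'` is `ℓ z · (ℓ m)⁻¹`, `m ∈ M` (localisation),
* the three dictionary clauses of the package (`t⁻¹`, vertex, base ideals).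
Def-free glue on the Literature §5 lemmas (`extendedReesMap`, `isLocalization_extendedRees`, `exists_ringEquiv_localization_extReesAlgebra`,
`mem_iff_extendedReesMap_mem_map`, `tInv_mem_iff_T_mem`, `vertexIdeal_le_iff_irrelevant_le`, `map_algebraMap_le_iff_map_algebraMap_le`).
OURS bookkeeping; nothing here is a claim about Hironaka's problem; AI-written, weaker than expert review.
[cite: Wlodarczyk2022, Def. 5.1.1; 3.3.12]
-/

noncomputable section

set_option linter.dupNamespace false -- mandated namespace of this single-conjunct summit

open CategoryTheory AlgebraicGeometry TopologicalSpace IsLocalRing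
open scoped LaurentPolynomial
open LaurentPolynomial
open Literature.AlgebraicGeometry.Resolution
open Summit.ResolutionOfSingularities.ResolutionOfSingularities.Theorems

namespace Summit.ResolutionOfSingularities.ResolutionOfSingularities.Cruxes.HypersurfaceCentreConstruction.LocalEngine

universe u v

section Generic

/-- `E₁ ((E₁ ≫ E₂⁻¹ ≫ E₃)⁻¹ v) = E₂ (E₃⁻¹ v)` (generic carriers, so that no instance unification happens at the use site). [folklore] -/
theorem ringEquiv_trans₃_symm_apply {A B C D : Type*} [Mul A] [Add A] [Mul B] [Add B] [Mul C] [Add C] [Mul D] [Add D]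
    (E₁ : A ≃+* B) (E₂ : C ≃+* B) (E₃ : C ≃+* D) (v : D) :
    E₁ ((E₁.trans (E₂.symm.trans E₃)).symm v) = E₂ (E₃.symm v) := by
  rw [RingEquiv.symm_trans_apply, RingEquiv.apply_symm_apply, RingEquiv.symm_trans_apply, RingEquiv.symm_symm]

/-- `(E ≫ g)⁻¹ (g v) = E⁻¹ v` (generic carriers). [folklore] -/
theorem ringEquiv_trans_symm_apply_apply {A B C : Type*} [Mul A] [Add A] [Mul B] [Add B] [Mul C] [Add C]
    (E : A ≃+* B) (g : B ≃+* C) (v : B) : (E.trans g).symm (g v) = E.symm v := by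
  rw [RingEquiv.symm_trans_apply, RingEquiv.symm_apply_apply]

end Generic

section Package

variable {A : Type u} [CommRing A] {A' : Type v} [CommRing A'] [Algebra A A']
  (F : IdealFiltration A) (M : Submonoid A) [IsLocalization M A']
  {I' : ℕ → Ideal A'} (hI' : ∀ n, I' n = (F.ideal n).map (algebraMap A A'))
  (𝔫 : Ideal F.extendedRees) [𝔫.IsPrime]
  (hd : Disjoint ((M.map (algebraMap A F.extendedRees) : Submonoid F.extendedRees) : Set F.extendedRees) 𝔫)

include M hI' hd

/-- **CHART → GAME SIDE at a prime, WITH THE COEFFICIENT MAP.** For the chart filtration `𝒥` on `A`, a localisation `A' = M⁻¹A`,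
ideals `Iₙ' = 𝒥ₙ A'`, and a prime `𝔫` of `⊕ 𝒥ₙ tⁿ` missing `M`: the coefficientwise localisation `ℓ : ⊕ 𝒥ₙ tⁿ → extReesAlgebra I'`,
a prime `𝔫'` of `extReesAlgebra I'` and a ring isomorphism `g : (⊕ 𝒥ₙ tⁿ)_𝔫 ≃+* (extReesAlgebra I')_{𝔫'}` with: the coefficient formula
for `ℓ`; `ℓ` on the base and on `t⁻¹`; `g (z/1) = (ℓ z)/1` for EVERY `z`; `z ∈ 𝔫 ↔ ℓ z ∈ 𝔫'`; every element of `extReesAlgebra I'` is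
`ℓ z` up to a unit `ℓ (m·1)`, `m ∈ M`; and the three dictionary clauses of res-type-048's package. [cite: Wlodarczyk2022, Def. 5.1.1] -/
theorem exists_coeffMap_prime_ringEquiv_localization :
    ∃ (ℓ : F.extendedRees →+* extReesAlgebra I') (𝔫' : Ideal (extReesAlgebra I')) (_ : 𝔫'.IsPrime)
      (g : Localization.AtPrime 𝔫 ≃+* Localization.AtPrime 𝔫'),
      (∀ z : F.extendedRees, ((ℓ z : extReesAlgebra I') : A'[T;T⁻¹]) =
        AddMonoidAlgebra.mapRingHom ℤ (algebraMap A A') (z : A[T;T⁻¹])) ∧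
      (∀ a : A, ℓ (algebraMap A F.extendedRees a) = algebraMap A' (extReesAlgebra I') (algebraMap A A' a)) ∧
      ℓ ⟨T (-1), F.T_neg_one_mem_extendedRees⟩ = extReesAlgebra.tInv I' ∧
      (∀ z : F.extendedRees, g (algebraMap F.extendedRees (Localization.AtPrime 𝔫) z) =
        algebraMap (extReesAlgebra I') (Localization.AtPrime 𝔫') (ℓ z)) ∧
      (∀ z : F.extendedRees, z ∈ 𝔫 ↔ ℓ z ∈ 𝔫') ∧
      (∀ c : extReesAlgebra I', ∃ (z : F.extendedRees) (m : A), m ∈ M ∧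
        c * ℓ (algebraMap A F.extendedRees m) = ℓ z) ∧
      (extReesAlgebra.tInv I' ∈ 𝔫' ↔ (⟨T (-1), F.T_neg_one_mem_extendedRees⟩ : F.extendedRees) ∈ 𝔫) ∧
      (extReesAlgebra.vertexIdeal I' ≤ 𝔫' ↔ F.irrelevant ≤ 𝔫) ∧
      (∀ 𝔭 : Ideal A, (𝔭.map (algebraMap A A')).map (algebraMap A' (extReesAlgebra I')) ≤ 𝔫' ↔
          𝔭.map (algebraMap A F.extendedRees) ≤ 𝔫) := by
  -- the localised filtration, built in place (as in the Literature §6 packaging)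
  let F' : IdealFiltration A' :=
    { ideal := I'
      ideal_zero := by rw [hI' 0, F.ideal_zero, Ideal.map_top]
      antitone := fun m n h => by rw [hI' m, hI' n]; exact Ideal.map_mono (F.antitone h)
      mul_le := fun m n => by
        rw [hI' m, hI' n, hI' (m + n), ← Ideal.map_mul]
        exact Ideal.map_mono (F.mul_le m n) }
  have heq : ∀ n, F'.ideal n = (F.ideal n).map (algebraMap A A') := hI'
  have hle : ∀ n, (F.ideal n).map (algebraMap A A') ≤ F'.ideal n := fun n => (heq n).ge
  have hF'I : F'.ideal = I' := rfl
  obtain ⟨e, he⟩ := F'.exists_ringEquiv_extReesAlgebra hF'I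
  haveI := F.isPrime_map_extendedReesMap F' M heq 𝔫 hd
  obtain ⟨g, hg⟩ := F.exists_ringEquiv_localization_extReesAlgebra F' M heq 𝔫 hd e
  -- the coefficient map
  let ℓ : F.extendedRees →+* extReesAlgebra I' := (e.symm : F'.extendedRees →+* extReesAlgebra I').comp (F.extendedReesMap F' hle)
  have hℓ : ∀ z, ℓ z = e.symm (F.extendedReesMap F' hle z) := fun _ => rfl
  refine ⟨ℓ, _, inferInstance, g, fun z => ?_, fun a => ?_, ?_, fun z => ?_, fun z => ?_, fun c => ?_,
    F.tInv_mem_iff_T_mem F' M heq 𝔫 hd e he, F.vertexIdeal_le_iff_irrelevant_le F' M heq 𝔫 hd e he hF'I,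
    fun 𝔭 => F.map_algebraMap_le_iff_map_algebraMap_le F' M heq 𝔫 hd e he 𝔭⟩
  · -- coefficient formula
    rw [hℓ, coe_symm_apply_eq e he, IdealFiltration.coe_extendedReesMap]
  · -- on the base
    rw [hℓ, IdealFiltration.extendedReesMap_algebraMap,
      ← apply_algebraMap_eq e.symm (coe_symm_apply_eq e he) (algebraMap A A' a)]
  · -- on `t⁻¹`
    rw [hℓ, IdealFiltration.extendedReesMap_T, ← F'.ringEquiv_tInv e he, RingEquiv.symm_apply_apply]
  · -- the whole compatibility
    rw [hg z, hℓ]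
  · -- the primes correspond
    rw [F.mem_iff_extendedReesMap_mem_map F' M heq 𝔫 hd z, hℓ,
      ← Ideal.apply_mem_of_equiv_iff (f := e.symm) (x := F.extendedReesMap F' hle z)]
  · -- localisation: every element is `ℓ z · (ℓ m)⁻¹`
    letI := (F.extendedReesMap F' hle).toAlgebra
    haveI := F.isLocalization_extendedRees F' M heq
    obtain ⟨⟨z, ⟨_, ⟨m, hm, rfl⟩⟩⟩, hzm⟩ := IsLocalization.surj (M.map (algebraMap A F.extendedRees)) (e c)
    refine ⟨z, m, hm, ?_⟩
    apply e.injective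
    simp only [map_mul, hℓ, RingEquiv.apply_symm_apply]
    exact hzm

end Package

/-! ## K4-E (I) along the chart `φ_U`, with the model read on EVERY section of the chart algebra -/

section Chart

variable {Y : Scheme.{0}} (R' : ReesFiltration Y) (U : Y.affineOpens)
  (φ : (R'.plusChart U : Scheme.{0}) ⟶ (R'.plus : Scheme.{0}))
  (hφ : φ ≫ R'.plus.ι = (R'.plusChart U).ι ≫ R'.openCover.f ⟨U.1, U.2⟩)

include hφ

/-- **K4-E (I) with the model read on the whole chart algebra**: the ring isomorphism `Ψ₀ : 𝒪_{B₊, φ_U x} ≃+* S_q` of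
`exists_stalk_ringEquiv_of_plusChartFac` (K4-E (I), same chain `E₁ ≫ E₂⁻¹ ≫ E₃`) carries strict transforms onto saturations AND satisfies
`φ_U^♯ (Ψ₀⁻¹ (z/1)) = ι^♯ (toStalk S (ι x) z)` for EVERY `z ∈ S = ⊕ 𝒥ₙ(U) tⁿ` (not only for the sections of the base):
`E₃⁻¹ (z/1) = toStalk S q z`, `E₂` IS `ι^♯`, `E₁` IS `φ_U^♯`. [cite: Wlodarczyk2022, 3.3.12] -/
theorem exists_stalk_ringEquiv_of_plusChartFac_coeff [IsLocallyNoetherian R'.cobordantBlowup] [IsOpenImmersion φ]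
    (x : (R'.plusChart U : Scheme.{0})) (q : PrimeSpectrum (R'.sectionsRing U)) (hq : (R'.plusChart U).ι x = q) :
    ∃ Ψ₀ : (R'.plus : Scheme.{0}).presheaf.stalk (φ x) ≃+* Localization.AtPrime q.asIdeal,
      (∀ K : Y.IdealSheafData,
        (stalkIdeal (R'.strictTransformPlus K) (φ x)).map
            (Ψ₀ : (R'.plus : Scheme.{0}).presheaf.stalk (φ x) →+* Localization.AtPrime q.asIdeal) =
          ⨆ n : ℕ, (((K.ideal U).map (algebraMap Γ(Y, U) (R'.sectionsRing U))).map
            (algebraMap (R'.sectionsRing U) (Localization.AtPrime q.asIdeal))).colon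
            {algebraMap (R'.sectionsRing U) (Localization.AtPrime q.asIdeal)
              ⟨T (-1), (R'.filtration U).T_neg_one_mem_extendedRees⟩ ^ n}) ∧
      ∀ z : R'.sectionsRing U, φ.stalkMap x (Ψ₀.symm (algebraMap (R'.sectionsRing U) (Localization.AtPrime q.asIdeal) z)) =
        (R'.plusChart U).ι.stalkMap x (StructureSheaf.toStalk (R'.sectionsRing U) ((R'.plusChart U).ι x) z) := by
  let E₁ : (R'.plus : Scheme.{0}).presheaf.stalk (φ x) ≃+* (R'.plusChart U : Scheme.{0}).presheaf.stalk x :=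
    (asIso (φ.stalkMap x)).commRingCatIsoToRingEquiv
  have hE20 := exists_stalk_ringEquiv_plusChartι_compat R' U x q hq
  obtain ⟨E₂, hE₂, hE₂s⟩ := hE20
  have hE30 := exists_stalk_ringEquiv_localization_Spec_compat (S := R'.sectionsRing U) q
  obtain ⟨E₃, hE₃, hE₃s⟩ := hE30
  refine ⟨E₁.trans (E₂.symm.trans E₃), fun K => ?_, fun z => ?_⟩
  · have h1 : (stalkIdeal (R'.strictTransformPlus K) (φ x)).map
        (E₁ : (R'.plus : Scheme.{0}).presheaf.stalk (φ x) →+* (R'.plusChart U : Scheme.{0}).presheaf.stalk x) =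
        stalkIdeal ((R'.strictTransformPlus K).comap φ) x :=
      (stalkIdeal_comap_eq_map_ringEquiv φ (R'.strictTransformPlus K) x).symm
    have h2 := (congrArg (fun Z : (R'.plusChart U : Scheme.{0}).IdealSheafData => (stalkIdeal Z x).map
        (E₂.symm : (R'.plusChart U : Scheme.{0}).presheaf.stalk x →+*
          (Spec (CommRingCat.of (R'.sectionsRing U))).presheaf.stalk q))
        (comap_strictTransformPlus_of_plusChartFac R' U φ hφ K)).trans (hE₂ _)
    have h3 := hE₃ (⨆ n : ℕ, ((K.ideal U).map (algebraMap Γ(Y, U) (R'.sectionsRing U))).colon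
        ((Ideal.span {(⟨T (-1), (R'.filtration U).T_neg_one_mem_extendedRees⟩ : R'.sectionsRing U)} ^ n :
          Ideal (R'.sectionsRing U)) : Set (R'.sectionsRing U)))
    have h4 := (congrArg (Ideal.map (algebraMap (R'.sectionsRing U) (Localization.AtPrime q.asIdeal)))
        (iSup_colon_span_pow_eq_iSup_colon_singleton_pow ((K.ideal U).map (algebraMap Γ(Y, U) (R'.sectionsRing U)))
          (⟨T (-1), (R'.filtration U).T_neg_one_mem_extendedRees⟩ : R'.sectionsRing U))).trans
      (map_iSup_colon_singleton_pow q.asIdeal (Localization.AtPrime q.asIdeal)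
        ((K.ideal U).map (algebraMap Γ(Y, U) (R'.sectionsRing U)))
        (⟨T (-1), (R'.filtration U).T_neg_one_mem_extendedRees⟩ : R'.sectionsRing U))
    exact ideal_map_ringEquiv_trans₃ E₁ E₂ E₃ h1 h2 (h3.trans h4)
  · -- `E₃⁻¹ (z/1) = toStalk S q z`, `E₂ (toStalk S q z) = ι^♯ (toStalk S (ι x) z)`, `E₁` IS `φ^♯` (generic-carrier rewriting only)
    have h4 := ringEquiv_trans₃_symm_apply E₁ E₂ E₃
      (algebraMap (R'.sectionsRing U) (Localization.AtPrime q.asIdeal) z)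
    have h3 : E₃.symm (algebraMap (R'.sectionsRing U) (Localization.AtPrime q.asIdeal) z) =
        StructureSheaf.toStalk (R'.sectionsRing U) q z := by
      apply E₃.injective
      rw [E₃.apply_symm_apply, hE₃s]
    exact (h4.trans (congrArg (fun t => E₂ t) h3)).trans (hE₂s z)

end Chart

/-! ## The game-side model with the coefficient map -/

section GameSideChart

variable {Y : Scheme.{0}} (R' : ReesFiltration Y) (U : Y.affineOpens)
  (φ : (R'.plusChart U : Scheme.{0}) ⟶ (R'.plus : Scheme.{0}))
  (hφ : φ ≫ R'.plus.ι = (R'.plusChart U).ι ≫ R'.openCover.f ⟨U.1, U.2⟩)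

include hφ

/-- **K4-E, GAME-SIDE FORM (chart version) WITH THE COEFFICIENT MAP.**  As `exists_gameSide_stalk_model_of_plusChartFac_compat` (p556325): for a
point `φ_U x` of `B₊` over `U = Spec A`, ANY localisation `A'` of `A` at `𝔮 = q ∩ A` (`q` the point of `Spec ⊕ 𝒥ₙ(U) tⁿ` under `x`) and the
localised pieces `I'ₙ = 𝒥ₙ(U) A'` — the coefficient map `ℓ : ⊕ 𝒥ₙ(U) tⁿ → extReesAlgebra I'`, a prime `𝔫'` and
`Ψ : 𝒪_{B₊, φ_U x} ≃+* (extReesAlgebra I')_{𝔫'}` with: (I) strict transforms ↦ `t⁻¹`-saturations; `𝔫'` off the vertex, over `𝔮 A'`,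
`t⁻¹ ∈ 𝔫' ↔ t⁻¹ ∈ q`; compatibility on the base `Ψ (σ₊^♯ a_y) = a/1`; AND the new clauses — `φ_U^♯ (Ψ⁻¹ ((ℓ z)/1)) = ι^♯ (toStalk S (ι x) z)`
for every `z`, `ℓ z ∈ 𝔫' ↔ z ∈ q`, every element of the carrier is `ℓ z · (ℓ (m·1))⁻¹` with `m ∉ 𝔮`, the coefficient formula for `ℓ`, `ℓ` on the
base and `ℓ t⁻¹ = t⁻¹`. [cite: Wlodarczyk2022, Def. 5.1.1; 3.3.12] -/
theorem exists_gameSide_stalk_model_of_plusChartFac_coeff [IsLocallyNoetherian R'.cobordantBlowup] [IsOpenImmersion φ]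
    (x : (R'.plusChart U : Scheme.{0})) (q : PrimeSpectrum (R'.sectionsRing U)) (hq : (R'.plusChart U).ι x = q)
    (hy : R'.πPlus (φ x) ∈ (U : Y.Opens))
    (𝔮 : Ideal Γ(Y, U)) [𝔮.IsPrime] (h𝔮 : q.asIdeal.comap (algebraMap Γ(Y, U) (R'.sectionsRing U)) = 𝔮)
    {A' : Type} [CommRing A'] [IsLocalRing A'] [Algebra Γ(Y, U) A'] [IsLocalization.AtPrime A' 𝔮]
    {I' : ℕ → Ideal A'} (hI' : ∀ n, I' n = ((R'.ideal n).ideal U).map (algebraMap Γ(Y, U) A')) :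
    ∃ (ℓ : R'.sectionsRing U →+* extReesAlgebra I') (𝔫' : Ideal (extReesAlgebra I')) (_ : 𝔫'.IsPrime)
      (Ψ : (R'.plus : Scheme.{0}).presheaf.stalk (φ x) ≃+* Localization.AtPrime 𝔫'),
      (∀ K : Y.IdealSheafData,
        (stalkIdeal (R'.strictTransformPlus K) (φ x)).map
            (Ψ : (R'.plus : Scheme.{0}).presheaf.stalk (φ x) →+* Localization.AtPrime 𝔫') =
          ⨆ n : ℕ, ((((K.ideal U).map (algebraMap Γ(Y, U) A')).map (algebraMap A' (extReesAlgebra I'))).map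
            (algebraMap (extReesAlgebra I') (Localization.AtPrime 𝔫'))).colon
            {algebraMap (extReesAlgebra I') (Localization.AtPrime 𝔫') (extReesAlgebra.tInv I') ^ n}) ∧
      ¬ extReesAlgebra.vertexIdeal I' ≤ 𝔫' ∧
      (maximalIdeal A').map (algebraMap A' (extReesAlgebra I')) ≤ 𝔫' ∧
      (extReesAlgebra.tInv I' ∈ 𝔫' ↔
        (⟨T (-1), (R'.filtration U).T_neg_one_mem_extendedRees⟩ : R'.sectionsRing U) ∈ q.asIdeal) ∧
      (∀ a : Γ(Y, U), Ψ ((R'.πPlus.stalkMap (φ x)) ((Y.presheaf.germ (U : Y.Opens) (R'.πPlus (φ x)) hy) a)) =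
        algebraMap (extReesAlgebra I') (Localization.AtPrime 𝔫')
          (algebraMap A' (extReesAlgebra I') (algebraMap Γ(Y, U) A' a))) ∧
      (∀ z : R'.sectionsRing U, φ.stalkMap x (Ψ.symm (algebraMap (extReesAlgebra I') (Localization.AtPrime 𝔫') (ℓ z))) =
        (R'.plusChart U).ι.stalkMap x (StructureSheaf.toStalk (R'.sectionsRing U) ((R'.plusChart U).ι x) z)) ∧
      (∀ z : R'.sectionsRing U, ℓ z ∈ 𝔫' ↔ z ∈ q.asIdeal) ∧
      (∀ c : extReesAlgebra I', ∃ (z : R'.sectionsRing U) (m : Γ(Y, U)), m ∉ 𝔮 ∧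
        c * ℓ (algebraMap Γ(Y, U) (R'.sectionsRing U) m) = ℓ z) ∧
      (∀ z : R'.sectionsRing U, ((ℓ z : extReesAlgebra I') : A'[T;T⁻¹]) =
        AddMonoidAlgebra.mapRingHom ℤ (algebraMap Γ(Y, U) A') (z : (Γ(Y, U))[T;T⁻¹])) ∧
      (∀ a : Γ(Y, U), ℓ (algebraMap Γ(Y, U) (R'.sectionsRing U) a) =
        algebraMap A' (extReesAlgebra I') (algebraMap Γ(Y, U) A' a)) ∧
      ℓ ⟨T (-1), (R'.filtration U).T_neg_one_mem_extendedRees⟩ = extReesAlgebra.tInv I' := by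
  have hK4 := exists_stalk_ringEquiv_of_plusChartFac_coeff R' U φ hφ x q hq
  obtain ⟨Ψ₀, hΨ₀, hΨ₀z⟩ := hK4
  -- the package WITH the coefficient map at the prime `q` of `S = ⊕ 𝒥ₙ(U) tⁿ`, which misses `A ∖ 𝔮`
  have hd : Disjoint ((𝔮.primeCompl.map (algebraMap Γ(Y, U) (R'.sectionsRing U)) :
      Submonoid (R'.sectionsRing U)) : Set (R'.sectionsRing U)) (q.asIdeal : Set (R'.sectionsRing U)) := by
    rw [Set.disjoint_left]
    rintro s ⟨a, ha, rfl⟩ hs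
    exact ha (show a ∈ 𝔮 by rw [← h𝔮]; exact hs)
  have hpk := exists_coeffMap_prime_ringEquiv_localization (R'.filtration U) 𝔮.primeCompl hI' q.asIdeal hd
  obtain ⟨ℓ, 𝔫', h𝔫', g, hℓcoe, hℓbase, hℓT, hg, hmem, hsurj, hgT, hgvert, hgprime⟩ := hpk
  have hgbase : ∀ a : Γ(Y, U), g (algebraMap (R'.sectionsRing U) (Localization.AtPrime q.asIdeal)
      (algebraMap Γ(Y, U) (R'.sectionsRing U) a)) =
      algebraMap (extReesAlgebra I') _ (algebraMap A' (extReesAlgebra I') (algebraMap Γ(Y, U) A' a)) := fun a => by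
    rw [hg, hℓbase]
  -- (I) on the game side
  have hcomp : ((g : Localization.AtPrime q.asIdeal →+* Localization.AtPrime 𝔫').comp
      (algebraMap (R'.sectionsRing U) (Localization.AtPrime q.asIdeal))).comp
        (algebraMap Γ(Y, U) (R'.sectionsRing U)) =
      ((algebraMap (extReesAlgebra I') (Localization.AtPrime 𝔫')).comp
        (algebraMap A' (extReesAlgebra I'))).comp (algebraMap Γ(Y, U) A') :=
    RingHom.ext fun a => hgbase a
  have hJ : ∀ K : Y.IdealSheafData, (((K.ideal U).map (algebraMap Γ(Y, U) (R'.sectionsRing U))).map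
      (algebraMap (R'.sectionsRing U) (Localization.AtPrime q.asIdeal))).map
      (g : Localization.AtPrime q.asIdeal →+* Localization.AtPrime 𝔫') =
      (((K.ideal U).map (algebraMap Γ(Y, U) A')).map (algebraMap A' (extReesAlgebra I'))).map
        (algebraMap (extReesAlgebra I') (Localization.AtPrime 𝔫')) := fun K => by
    rw [Ideal.map_map, Ideal.map_map, hcomp, ← Ideal.map_map, ← Ideal.map_map]
  have hgtInv : g (algebraMap (R'.sectionsRing U) (Localization.AtPrime q.asIdeal)
      ⟨T (-1), (R'.filtration U).T_neg_one_mem_extendedRees⟩) =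
      algebraMap (extReesAlgebra I') _ (extReesAlgebra.tInv I') := by rw [hg, hℓT]
  have hA := fun K : Y.IdealSheafData =>
    @map_iSup_colon_singleton_pow_of_ringEquiv (Localization.AtPrime q.asIdeal) _ (Localization.AtPrime 𝔫') _ g
      _ _ (hJ K) _ _ hgtInv
  have hB : ∀ K : Y.IdealSheafData, (stalkIdeal (R'.strictTransformPlus K) (φ x)).map
      ((Ψ₀.trans g : (R'.plus : Scheme.{0}).presheaf.stalk (φ x) ≃+* Localization.AtPrime 𝔫') :
        (R'.plus : Scheme.{0}).presheaf.stalk (φ x) →+* Localization.AtPrime 𝔫') =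
      ⨆ n : ℕ, ((((K.ideal U).map (algebraMap Γ(Y, U) A')).map (algebraMap A' (extReesAlgebra I'))).map
        (algebraMap (extReesAlgebra I') (Localization.AtPrime 𝔫'))).colon
        {algebraMap (extReesAlgebra I') (Localization.AtPrime 𝔫') (extReesAlgebra.tInv I') ^ n} := fun K =>
    (Ideal.map_map (Ψ₀ : (R'.plus : Scheme.{0}).presheaf.stalk (φ x) →+* Localization.AtPrime q.asIdeal)
      (g : Localization.AtPrime q.asIdeal →+* Localization.AtPrime 𝔫')).symm.trans
      ((congrArg (Ideal.map (g : Localization.AtPrime q.asIdeal →+* Localization.AtPrime 𝔫')) (hΨ₀ K)).trans (hA K))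
  have hV : ¬ extReesAlgebra.vertexIdeal I' ≤ 𝔫' := by
    rw [hgvert]
    exact not_irrelevant_le_of_plusChart R' U x q hq
  have hM : (maximalIdeal A').map (algebraMap A' (extReesAlgebra I')) ≤ 𝔫' := by
    rw [← IsLocalization.AtPrime.map_eq_maximalIdeal 𝔮 A', hgprime 𝔮, Ideal.map_le_iff_le_comap, h𝔮]
  -- the model read on every section of the chart algebra: `Ψ⁻¹ ((ℓ z)/1) = Ψ₀⁻¹ (z/1)`
  have hZ : ∀ z : R'.sectionsRing U, (Ψ₀.trans g).symm (algebraMap (extReesAlgebra I') (Localization.AtPrime 𝔫') (ℓ z)) =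
      Ψ₀.symm (algebraMap (R'.sectionsRing U) (Localization.AtPrime q.asIdeal) z) := fun z =>
    (congrArg (fun t => (Ψ₀.trans g).symm t) (hg z)).symm.trans (ringEquiv_trans_symm_apply_apply Ψ₀ g _)
  -- compatibility on the base, from the whole-algebra clause and `stalkMap_plusChartFac_stalkMap_πPlus_germ` (injectivity of `φ^♯`)
  have hinj : Function.Injective (φ.stalkMap x) :=
    (ConcreteCategory.bijective_of_isIso (φ.stalkMap x)).1
  have hC : ∀ a : Γ(Y, U), (Ψ₀.trans g) ((R'.πPlus.stalkMap (φ x))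
      ((Y.presheaf.germ (U : Y.Opens) (R'.πPlus (φ x)) hy) a)) =
      algebraMap (extReesAlgebra I') (Localization.AtPrime 𝔫')
        (algebraMap A' (extReesAlgebra I') (algebraMap Γ(Y, U) A' a)) := fun a => by
    have h1 : φ.stalkMap x ((Ψ₀.trans g).symm (algebraMap (extReesAlgebra I') (Localization.AtPrime 𝔫')
        (ℓ (algebraMap Γ(Y, U) (R'.sectionsRing U) a)))) =
        φ.stalkMap x ((R'.πPlus.stalkMap (φ x)) ((Y.presheaf.germ (U : Y.Opens) (R'.πPlus (φ x)) hy) a)) :=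
      ((congrArg (fun t => φ.stalkMap x t) (hZ _)).trans (hΨ₀z _)).trans
        (stalkMap_plusChartFac_stalkMap_πPlus_germ R' U φ hφ x hy a).symm
    have h2 := hinj h1
    exact ((congrArg (fun t => (Ψ₀.trans g) t) h2).symm.trans ((Ψ₀.trans g).apply_symm_apply _)).trans
      (congrArg (fun t => algebraMap (extReesAlgebra I') (Localization.AtPrime 𝔫') t) (hℓbase a))
  refine ⟨ℓ, 𝔫', h𝔫', Ψ₀.trans g, hB, hV, hM, hgT, hC, fun z => ?_, fun z => (hmem z).symm, fun c => ?_, hℓcoe, hℓbase, hℓT⟩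
  · exact (congrArg (fun t => φ.stalkMap x t) (hZ z)).trans (hΨ₀z z)
  · obtain ⟨z, m, hm, hzm⟩ := hsurj c
    exact ⟨z, m, hm, hzm⟩

end GameSideChart

end Summit.ResolutionOfSingularities.ResolutionOfSingularities.Cruxes.HypersurfaceCentreConstruction.LocalEngine

end
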